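import Summits.RiemannHypothesis.RiemannHypothesis.Theorems.ZetaStringKreinWindow
import Summits.RiemannHypothesis.RiemannHypothesis.Theorems.SemilocalNegCertEmpty
import Literature.NumberTheory.LFunctions.ZetaScrewThm43Proofs
import Literature.NumberTheory.LFunctions.ZetaScrewHermitianFormsProofs
import Literature.NumberTheory.LFunctions.WeilMarkovQuadratic
import Mathlib.MeasureTheory.Integral.Prod
import HarnessLib

/-!
# The archimedean semi-local form IS the hermitian form of the wall kernel: `Q_∅(ψ) = ⟨ψ′, ψ′⟩_{G_∅,a}` (column DBR ↔ column WEIL; RH-FREE identity)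

LINE 1 — LABEL: RH-FREE identities between two explicit quadratic forms (no positivity is asserted; nothing here
bears on the truth of RH). bears_on: LADDER-RH B-D → B-P(P1) (cell rh-dbr, ET6 row `N = 2` / TARGET-v7 §K.2
`ArchWallHolds`; cross-column dictionary with cell rh-explicit's `weilSemilocalThreshold ∅`, XCOL note
2026-08-26). WHAT THIS IS NOT: not progress toward RH; a statement about the prime-free parts of the explicit
formula and of Suzuki's screw function only.

**The dictionary, function level.** Column DBR's archimedean wall is the prime-free part
`Ψ_∅ = Ψ + φ` of Suzuki's screw function (`archScrew = zetaScrew + zetaScrewPrimeSum`,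
`Theorems/ZetaStringArchWallDefs.lean`) with Kreĭn kernel `G_∅(t,u) = Ψ_∅(t) + Ψ_∅(u) − Ψ_∅(t − u)` (`archKernel`);
column WEIL's archimedean object is the semi-local Weil form at `S = ∅`,
`Q_∅(g) = W_∅(g ⋆ g̃)`, `W_∅ = polar + archimedean` (`weilSemilocalQuadratic ∅`,
`Literature/NumberTheory/LFunctions/WeilSemilocalQuadratic.lean`). This file proves, for `0 < a` and `ψ ∈ C(a)`
(smooth, `tsupport ψ ⊆ [−a, a]`):

`Q_∅(ψ) = ∫_{(−a,a)} ∫_{(−a,a)} G_∅(t,u) ψ′(u) conj ψ′(t) du dt`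
(`weilSemilocalQuadratic_empty_eq_archForm`).

**Proof.** `Q_∅(ψ) = Q(ψ) + P(ψ ⋆ ψ̃)` with `P` the prime term of the explicit formula (the `∅`-smooth prime term
vanishes, `weilSemilocalPrimeTerm_empty`); `Q(ψ) = ⟨ψ′, ψ′⟩_{G,a}` is Suzuki 2023 Prop. 3.1 in the tree's
normalisation (`weilQuadratic_eq_zetaScrewForm_deriv`); and `G_∅ = G + K_φ` with `K_φ` the Kreĭn kernel of the prime
sum `φ(v) = Σ_{n ≤ e^{|v|}} Λ(n) n^{-1/2}(|v| − log n)`. The new ingredient is the RAMP IDENTITY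
`⟨ψ′, ψ′⟩_{K_φ,a} = P(ψ ⋆ ψ̃)` (`setIntegral_setIntegral_kreinKernel_primeSum_deriv`): by the mean-zero reduction
`⟨f,f⟩_{K_F} = −∫∫ F(t−u) f(u) conj f(t)` (`∫ψ′ = 0`), the tree's triangle identity
`∫∫ φ(t−u) f(u) conj f(t) = Σ_n Λ(n) n^{-1/2}(−2‖ψ‖² + ‖ψ − ψ(· − log n)‖²)` for `f = ψ′`
(`Suzuki2023Thm43.integral_prod_primeSum_mul`, Suzuki 2023 §4.3 (4.6)/(4.8)), and the increment identity
`k(log n) + k(−log n) = 2‖ψ‖² − ‖ψ − ψ(· − log n)‖²`, `k = ψ ⋆ ψ̃` (`weilConv_weilReflect_add_neg`).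

References: M. Suzuki, J. Lond. Math. Soc. (2) 108 (2023) = arXiv:2206.03682, (1.1), (1.4), (1.10), Prop. 3.1, §4.3
(4.3)–(4.8); E. Bombieri, Rend. Mat. Acc. Lincei (9) 11 (2000) Thm 2 (prime term); A. Connes, Selecta Math. 5 (1999)
§VII Thm 4 (semi-local functional).
-/

-- `Summit.RiemannHypothesis.RiemannHypothesis.…` duplicates `RiemannHypothesis` BY DESIGN (D-0017).
set_option linter.dupNamespace false

noncomputable section

open MeasureTheory Set Filter
open scoped ComplexConjugate BigOperators

namespace Summit.RiemannHypothesis.RiemannHypothesis.Theorems.ZetaStringArchWall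

open Literature.NumberTheory.LFunctions Literature.Analysis.Complex
open Summit.RiemannHypothesis.RiemannHypothesis.Theorems.MotivicDoor.SemilocalMarkov
  (weilSemilocalPrimeTerm_empty)

variable {a : ℝ} {f : ℝ → ℂ}

/-! ## §1 Mean-zero reduction for the Kreĭn kernel of a continuous function -/

/-- `(t,u) ↦ f(u) conj f(t)` is integrable on `ℝ × ℝ` for integrable `f`. [folklore] -/
theorem integrable_mul_conj_prod (hfi : Integrable f) :
    Integrable (fun p : ℝ × ℝ => f p.2 * conj (f p.1)) (volume.prod volume) := by
  have hconj : Integrable fun x : ℝ => conj (f x) :=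
    hfi.mono (Complex.continuous_conj.comp_aestronglyMeasurable hfi.aestronglyMeasurable)
      (Eventually.of_forall fun x => by simp)
  simpa [mul_comm] using hconj.mul_prod hfi

/-- A continuous real weight against `f(u) conj f(t)`, with `f` integrable and vanishing off `(−a, a)`, is
integrable on `ℝ × ℝ` (the integrand lives on the bounded square, where the weight is bounded). [folklore] -/
theorem integrable_ofReal_mul_mul_conj_prod (hfi : Integrable f) (hf0 : ∀ t ∉ Ioo (-a) a, f t = 0)
    {G : ℝ × ℝ → ℝ} (hG : Continuous G) :
    Integrable (fun p : ℝ × ℝ => (G p : ℂ) * (f p.2 * conj (f p.1))) (volume.prod volume) := by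
  obtain ⟨M, hM⟩ := ((isCompact_Icc (a := -a) (b := a)).prod
    (isCompact_Icc (a := -a) (b := a))).exists_bound_of_continuousOn hG.continuousOn
  refine ((integrable_mul_conj_prod hfi).norm.const_mul M).mono'
    ((Complex.continuous_ofReal.comp hG).aestronglyMeasurable.mul
      (integrable_mul_conj_prod hfi).aestronglyMeasurable) (Eventually.of_forall fun p => ?_)
  by_cases h1 : p.1 ∈ Ioo (-a) a
  · by_cases h2 : p.2 ∈ Ioo (-a) a
    · rw [norm_mul, Complex.norm_real]
      gcongr
      exact hM p ⟨Ioo_subset_Icc_self h1, Ioo_subset_Icc_self h2⟩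
    · simp [hf0 _ h2]
  · simp [hf0 _ h1]

/-- The hermitian form of the Kreĭn kernel `K_F(t,u) = F(t) + F(u) − F(t − u)` of a continuous `F` on the window
`(−a, a)`, as an integral over `ℝ × ℝ` (the weight `f` vanishes off the window). [folklore] -/
theorem setIntegral_setIntegral_kreinKernel_eq_integral_prod {F : ℝ → ℝ} (hF : Continuous F)
    (hfi : Integrable f) (hf0 : ∀ t ∉ Ioo (-a) a, f t = 0) :
    ∫ t in Ioo (-a) a, ∫ u in Ioo (-a) a, kreinKernel F t u * f u * conj (f t) =
      ∫ p : ℝ × ℝ, kreinKernel F p.1 p.2 * (f p.2 * conj (f p.1)) ∂(volume.prod volume) := by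
  have hinner : ∀ t : ℝ, ∫ u in Ioo (-a) a, kreinKernel F t u * f u * conj (f t) =
      ∫ u, kreinKernel F t u * (f u * conj (f t)) := by
    intro t
    rw [setIntegral_eq_integral_of_forall_compl_eq_zero fun u hu => by
      rw [hf0 u hu, mul_zero, zero_mul]]
    exact integral_congr_ae (Eventually.of_forall fun u => mul_assoc _ _ _)
  simp_rw [hinner]
  have hK : Continuous fun p : ℝ × ℝ => F p.1 + F p.2 - F (p.1 - p.2) :=
    ((hF.comp continuous_fst).add (hF.comp continuous_snd)).sub (hF.comp (continuous_fst.sub continuous_snd))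
  have hint := integrable_ofReal_mul_mul_conj_prod hfi hf0 hK
  rw [setIntegral_eq_integral_of_forall_compl_eq_zero fun t ht => ?_]
  · rw [integral_prod _ (by simpa [kreinKernel] using hint)]
  · simp [hf0 t ht]

/-- **Mean-zero reduction.** For `f` integrable, vanishing off `(−a, a)` and of mean zero, the hermitian form of
`K_F` is `−∫∫ F(t − u) f(u) conj f(t) du dt` (the terms `F(t)`, `F(u)` integrate to zero).
[cite: Suzuki2023, (1.4) and (1.10), p. 3] -/
theorem setIntegral_setIntegral_kreinKernel_eq_neg_integral_prod {F : ℝ → ℝ} (hF : Continuous F)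
    (hfi : Integrable f) (hf0 : ∀ t ∉ Ioo (-a) a, f t = 0) (hmean : ∫ t, f t = 0) :
    ∫ t in Ioo (-a) a, ∫ u in Ioo (-a) a, kreinKernel F t u * f u * conj (f t) =
      -∫ p : ℝ × ℝ, (F (p.1 - p.2) : ℂ) * (f p.2 * conj (f p.1)) ∂(volume.prod volume) := by
  rw [setIntegral_setIntegral_kreinKernel_eq_integral_prod hF hfi hf0]
  have hsplit : ∀ p : ℝ × ℝ, kreinKernel F p.1 p.2 * (f p.2 * conj (f p.1)) =
      (F p.1 : ℂ) * (f p.2 * conj (f p.1)) + (F p.2 : ℂ) * (f p.2 * conj (f p.1)) -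
        (F (p.1 - p.2) : ℂ) * (f p.2 * conj (f p.1)) := by
    intro p
    rw [kreinKernel]
    push_cast
    ring
  simp_rw [hsplit]
  have i1 := integrable_ofReal_mul_mul_conj_prod hfi hf0 (G := fun p : ℝ × ℝ => F p.1)
    (hF.comp continuous_fst)
  have i2 := integrable_ofReal_mul_mul_conj_prod hfi hf0 (G := fun p : ℝ × ℝ => F p.2)
    (hF.comp continuous_snd)
  have i3 := integrable_ofReal_mul_mul_conj_prod hfi hf0 (G := fun p : ℝ × ℝ => F (p.1 - p.2))
    (hF.comp (continuous_fst.sub continuous_snd))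
  have i12 : Integrable (fun p : ℝ × ℝ => (F p.1 : ℂ) * (f p.2 * conj (f p.1)) +
      (F p.2 : ℂ) * (f p.2 * conj (f p.1))) (volume.prod volume) := i1.add i2
  rw [integral_sub i12 i3, integral_add i1 i2]
  have h1 : ∫ p : ℝ × ℝ, (F p.1 : ℂ) * (f p.2 * conj (f p.1)) ∂(volume.prod volume) = 0 := by
    have : ∀ p : ℝ × ℝ, (F p.1 : ℂ) * (f p.2 * conj (f p.1)) = ((F p.1 : ℂ) * conj (f p.1)) * f p.2 :=
      fun p => by ring
    simp_rw [this]
    rw [integral_prod_mul (fun t : ℝ => (F t : ℂ) * conj (f t)) f, hmean, mul_zero]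
  have h2 : ∫ p : ℝ × ℝ, (F p.2 : ℂ) * (f p.2 * conj (f p.1)) ∂(volume.prod volume) = 0 := by
    have : ∀ p : ℝ × ℝ, (F p.2 : ℂ) * (f p.2 * conj (f p.1)) = conj (f p.1) * ((F p.2 : ℂ) * f p.2) :=
      fun p => by ring
    simp_rw [this]
    rw [integral_prod_mul (fun t : ℝ => conj (f t)) (fun u : ℝ => (F u : ℂ) * f u),
      integral_conj, hmean, map_zero, zero_mul]
  rw [h1, h2, zero_add, zero_sub]

/-! ## §2 The ramp identity: the prime-sum kernel against `ψ′` is the prime term of `ψ ⋆ ψ̃` -/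

/-- For `ψ ∈ C(a)`, `ψ′` vanishes off the open window `(−a, a)`. [folklore] -/
theorem deriv_apply_eq_zero_of_not_mem {ψ : ℝ → ℂ} (hψ : ψ ∈ screwTestC a) {x : ℝ} (hx : x ∉ Ioo (-a) a) :
    deriv ψ x = 0 := by
  by_contra hne
  exact hx (support_subset_Ioo_of_tsupport_subset_Icc (hψ.1.1.continuous_deriv (by simp))
    (tsupport_deriv_subset.trans hψ.2) (Function.mem_support.2 hne))

/-- `k(log n) + k(−log n) = 2‖ψ‖₂² − ‖ψ − ψ(· − log n)‖₂²` for `k = ψ ⋆ ψ̃`, in the shape produced by the triangle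
identity. [folklore] -/
theorem weilConv_weilReflect_log_add_neg {ψ : ℝ → ℂ} (hψ : IsWeilTest ψ) (n : ℕ) :
    weilConv ψ (weilReflect ψ) (Real.log n) + weilConv ψ (weilReflect ψ) (-Real.log n) =
      -(((-2 * (∫ x, ‖ψ x‖ ^ 2) + ∫ x, ‖ψ x - ψ (x - Real.log n)‖ ^ 2 : ℝ) : ℂ)) := by
  rw [weilConv_weilReflect_add_neg hψ, weilIncrement_eq_integral_sub]
  push_cast
  ring

/-- For `ψ ∈ C(a)` and `e^{2a} ≤ M`, the prime term of `k = ψ ⋆ ψ̃` is the finite sum over `1 ≤ n ≤ M`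
(`k` vanishes at `|t| ≥ 2a`). [cite: Bombieri2000Weil, Thm 2 (p. 193), prime term] -/
theorem weilPrimeTerm_weilConv_weilReflect_eq_sum_Icc {ψ : ℝ → ℂ} (hψ : ψ ∈ screwTestC a) {M : ℕ}
    (hM : Real.exp (2 * a) ≤ M) :
    weilPrimeTerm (weilConv ψ (weilReflect ψ)) =
      ∑ n ∈ Finset.Icc 1 M, ((ArithmeticFunction.vonMangoldt n : ℝ) : ℂ) / (Real.sqrt n : ℂ) *
        (weilConv ψ (weilReflect ψ) (Real.log n) + weilConv ψ (weilReflect ψ) (-Real.log n)) := by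
  unfold weilPrimeTerm
  refine tsum_eq_sum fun n hn => ?_
  rw [Finset.mem_Icc, not_and_or, not_le, not_le] at hn
  rcases hn with hn | hn
  · have hn0 : n = 0 := by omega
    subst hn0
    simp
  · have hnpos : (0 : ℝ) < n := by exact_mod_cast (show 0 < n by omega)
    have hlog : 2 * a ≤ Real.log n := by
      rw [Real.le_log_iff_exp_le hnpos]
      exact hM.trans (by exact_mod_cast hn.le)
    have h0 : 0 ≤ Real.log n := Real.log_natCast_nonneg n
    rw [weilConv_weilReflect_eq_zero_of_le_abs hψ.1 hψ.2 (by rwa [abs_of_nonneg h0]),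
      weilConv_weilReflect_eq_zero_of_le_abs hψ.1 hψ.2 (by rwa [abs_neg, abs_of_nonneg h0]),
      add_zero, mul_zero]

/-- **The ramp identity.** For `0 < a` and `ψ ∈ C(a)`, the hermitian form of the Kreĭn kernel of the prime sum
`φ(v) = Σ_{n ≤ e^{|v|}} Λ(n) n^{-1/2}(|v| − log n)` against `ψ′` is the prime term of the explicit formula at
`k = ψ ⋆ ψ̃`:
`∫_{(−a,a)}∫_{(−a,a)} (φ(t) + φ(u) − φ(t−u)) ψ′(u) conj ψ′(t) du dt = Σ_n Λ(n) n^{-1/2} (k(log n) + k(−log n))`.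
(Mean-zero reduction, the triangle identity of Suzuki 2023 §4.3 for each ramp `(|v| − log n)₊`, and
`k(t) + k(−t) = 2‖ψ‖² − ‖ψ − ψ(·−t)‖²`.) [cite: Suzuki2023, §4.3 eq. (4.6) and (4.8), arXiv p. 9] -/
theorem setIntegral_setIntegral_kreinKernel_primeSum_deriv (ha : 0 < a) {ψ : ℝ → ℂ} (hψ : ψ ∈ screwTestC a) :
    ∫ t in Ioo (-a) a, ∫ u in Ioo (-a) a,
        kreinKernel zetaScrewPrimeSum t u * deriv ψ u * conj (deriv ψ t) =
      weilPrimeTerm (weilConv ψ (weilReflect ψ)) := by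
  have hφ : deriv ψ ∈ screwTestC0 a := deriv_mem_screwTestC0 hψ
  have hfi : Integrable (deriv ψ) := hφ.1.1.continuous.integrable_of_hasCompactSupport hφ.1.2
  have hf0 : ∀ t ∉ Ioo (-a) a, deriv ψ t = 0 := fun t ht => deriv_apply_eq_zero_of_not_mem hψ ht
  have hmean : ∫ t, deriv ψ t = 0 := hφ.2.2
  rw [setIntegral_setIntegral_kreinKernel_eq_neg_integral_prod continuous_zetaScrewPrimeSum hfi hf0 hmean]
  -- the triangle identity of Suzuki 2023 §4.3, with `I₀^{(a)} ψ′ = ψ`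
  set M : ℕ := ⌈Real.exp (2 * a)⌉₊ with hMdef
  have hM : Real.exp (2 * a) ≤ M := Nat.le_ceil _
  rw [Suzuki2023Thm43.integral_prod_primeSum_mul ha hfi hf0 hmean hM, screwPrimitive_deriv_of_mem hψ,
    weilPrimeTerm_weilConv_weilReflect_eq_sum_Icc hψ hM]
  push_cast
  rw [← Finset.sum_neg_distrib]
  refine Finset.sum_congr rfl fun n _ => ?_
  rw [weilConv_weilReflect_log_add_neg hψ.1 n]
  push_cast
  ring

/-! ## §3 `Q_∅(ψ) = ⟨ψ′, ψ′⟩_{G_∅,a}` -/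

/-- `Q_∅(g) = Q(g) + P(g ⋆ g̃)`: the semi-local form at `S = ∅` is Weil's form with the prime term ADDED BACK (the
`∅`-smooth prime term vanishes; `W = polar − prime + arch`, `W_∅ = polar + arch`). [cite: Connes1999, §VII Thm 4 (semi-local functional, S = ∅)] -/
theorem weilSemilocalQuadratic_empty_eq_weilQuadratic_add (g : ℝ → ℂ) :
    weilSemilocalQuadratic ∅ g = weilQuadratic g + weilPrimeTerm (weilConv g (weilReflect g)) := by
  unfold weilSemilocalQuadratic weilSemilocalFunctional weilQuadratic weilFunctional
  rw [weilSemilocalPrimeTerm_empty]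
  ring

/-- The wall kernel is Suzuki's kernel plus the Kreĭn kernel of the prime sum: `G_∅ = G + K_φ`
(`Ψ_∅ = Ψ + φ`). [cite: Suzuki2023, (1.1) and (1.4)] -/
theorem archKernel_eq_zetaScrewKernel_add (t u : ℝ) :
    archKernel t u = (zetaScrewKernel t u : ℂ) + kreinKernel zetaScrewPrimeSum t u := by
  simp only [archKernel, archScrew, zetaScrewKernel, kreinKernel]
  push_cast
  ring

/-- Suzuki's hermitian form `⟨ψ′, ψ′⟩_{G,a}` written with the Kreĭn kernel of `Ψ`. [cite: Suzuki2023, (1.4) and (1.10)] -/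
theorem zetaScrewForm_deriv_eq_setIntegral_kreinKernel (ψ : ℝ → ℂ) :
    zetaScrewForm (Ioo (-a) a) (deriv ψ) (deriv ψ) =
      ∫ t in Ioo (-a) a, ∫ u in Ioo (-a) a, kreinKernel zetaScrew t u * deriv ψ u * conj (deriv ψ t) := by
  unfold zetaScrewForm
  rfl

/-- **`Q_∅(ψ) = ⟨ψ′, ψ′⟩_{G_∅,a}`** — RH-FREE identity, the function-level dictionary between column WEIL's
semi-local form at `S = ∅` and column DBR's archimedean wall: for `0 < a` and `ψ ∈ C(a)`,
`W_∅(ψ ⋆ ψ̃) = ∫_{(−a,a)}∫_{(−a,a)} (Ψ_∅(t) + Ψ_∅(u) − Ψ_∅(t−u)) ψ′(u) conj ψ′(t) du dt`.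
(Suzuki 2023 Prop. 3.1 for `Q`, plus the ramp identity for the prime term.) Nothing here bears on RH.
[cite: Suzuki2023, Prop 3.1 and §4.3 (4.6)/(4.8)] -/
theorem weilSemilocalQuadratic_empty_eq_archForm (ha : 0 < a) {ψ : ℝ → ℂ} (hψ : ψ ∈ screwTestC a) :
    weilSemilocalQuadratic ∅ ψ =
      ∫ t in Ioo (-a) a, ∫ u in Ioo (-a) a, archKernel t u * deriv ψ u * conj (deriv ψ t) := by
  have hφ : deriv ψ ∈ screwTestC0 a := deriv_mem_screwTestC0 hψ
  have hfi : Integrable (deriv ψ) := hφ.1.1.continuous.integrable_of_hasCompactSupport hφ.1.2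
  have hf0 : ∀ t ∉ Ioo (-a) a, deriv ψ t = 0 := fun t ht => deriv_apply_eq_zero_of_not_mem hψ ht
  have hA : Continuous archScrew := by
    show Continuous fun t => zetaScrew t + zetaScrewPrimeSum t
    exact continuous_zetaScrew.add continuous_zetaScrewPrimeSum
  rw [← kreinKernel_archScrew, setIntegral_setIntegral_kreinKernel_eq_integral_prod hA hfi hf0,
    weilSemilocalQuadratic_empty_eq_weilQuadratic_add, weilQuadratic_eq_zetaScrewForm_deriv ha hψ,
    zetaScrewForm_deriv_eq_setIntegral_kreinKernel,
    ← setIntegral_setIntegral_kreinKernel_primeSum_deriv ha hψ,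
    setIntegral_setIntegral_kreinKernel_eq_integral_prod continuous_zetaScrew hfi hf0,
    setIntegral_setIntegral_kreinKernel_eq_integral_prod continuous_zetaScrewPrimeSum hfi hf0]
  have i1 : Integrable (fun p : ℝ × ℝ =>
      kreinKernel zetaScrew p.1 p.2 * (deriv ψ p.2 * conj (deriv ψ p.1))) (volume.prod volume) := by
    simpa only [kreinKernel] using integrable_ofReal_mul_mul_conj_prod hfi hf0
      (G := fun p : ℝ × ℝ => zetaScrew p.1 + zetaScrew p.2 - zetaScrew (p.1 - p.2))
      (((continuous_zetaScrew.comp continuous_fst).add (continuous_zetaScrew.comp continuous_snd)).sub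
        (continuous_zetaScrew.comp (continuous_fst.sub continuous_snd)))
  have i2 : Integrable (fun p : ℝ × ℝ =>
      kreinKernel zetaScrewPrimeSum p.1 p.2 * (deriv ψ p.2 * conj (deriv ψ p.1))) (volume.prod volume) := by
    simpa only [kreinKernel] using integrable_ofReal_mul_mul_conj_prod hfi hf0
      (G := fun p : ℝ × ℝ => zetaScrewPrimeSum p.1 + zetaScrewPrimeSum p.2 - zetaScrewPrimeSum (p.1 - p.2))
      (((continuous_zetaScrewPrimeSum.comp continuous_fst).add
        (continuous_zetaScrewPrimeSum.comp continuous_snd)).sub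
        (continuous_zetaScrewPrimeSum.comp (continuous_fst.sub continuous_snd)))
  rw [← integral_add i1 i2]
  refine integral_congr_ae (Eventually.of_forall fun p => ?_)
  simp only [kreinKernel, archScrew]
  push_cast
  ring

/-- Real-part form of the dictionary: `Re Q_∅(ψ) = Re ⟨ψ′, ψ′⟩_{G_∅,a}` for `ψ ∈ C(a)`, `0 < a`. [cite: Suzuki2023, Prop 3.1] -/
theorem re_weilSemilocalQuadratic_empty_eq_archForm (ha : 0 < a) {ψ : ℝ → ℂ} (hψ : ψ ∈ screwTestC a) :
    (weilSemilocalQuadratic ∅ ψ).re =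
      (∫ t in Ioo (-a) a, ∫ u in Ioo (-a) a, archKernel t u * deriv ψ u * conj (deriv ψ t)).re := by
  rw [weilSemilocalQuadratic_empty_eq_archForm ha hψ]

end Summit.RiemannHypothesis.RiemannHypothesis.Theorems.ZetaStringArchWall

end
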